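import Literature.Computability.Complexity.PlethysmStabilityBIP
import Literature.Computability.AlgebraicComplexity.HwvIdealProducts
import Literature.NumberTheory.DiophantineGeometry.SchurWeylPlethysmOrbitWeightsProofs
import HarnessLib

/-!
# The semigroup property of orbit-closure MULTIPLICITIES, and outer monotonicity

Topic `Literature/Computability/AlgebraicComplexity` (geometric complexity theory); proofs file
(theorems only: no definitions, no named facts). Honest framing of the cell served (`pub-gct`,
papers/PneNP/gct-obstructions): rung-1 multiplicity-obstruction search for permanent versus
determinant at small `(n, m)`; no claim about VP ≠ VNP or P ≠ NP.

For a form `f ∈ Sym^m(k^σ)` over an infinite field `k`, write `k[Δ_m(f)] = k[Sym^m] ⧸ I(GL · f)`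
(`OrbitCoordRing f m`, representation `orbitCoordRep f m`) and
`mult_χ = orbitMultiplicity k f m χ = dim_k HWV_χ(k[Δ_m(f)])`.

1. `eval_pi_single_one_of_isHomogeneous` — for a form `h` of degree `m`, the value `h(e_i)` at a
   coordinate vector is the coefficient of the pure power `x_i^m`. [folklore]
2. `X_not_mem_orbitVanishingIdeal_of_eq_single` — **the coordinate function of a pure power
   `x_i^m` never vanishes on the orbit of a nonzero form**: `X_{x_i^m}(A · f) = f(row_i A)`, and a
   nonzero polynomial over an infinite field has a nonzero value. (BIP 2019 §6(a) is the case
   `f = det_n`: "`X_1^n ∈ Ω_n` … `⟨e_{11}^n, X_1^n⟩ = 1`"; tree: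
   `X_single_top_not_mem_orbitVanishingIdeal_detFormLex`.) [folklore]
3. `orbitMultiplicity_le_orbitMultiplicity_add_of_ne_zero` / `_of_hasHighestWeight` — **the
semigroup property in
   multiplicity form** (Bläser–Ikenmeyer, ToC Graduate Surveys 10 (2025), Prop. 21.17: "If the type
   `λ` occurs with positive multiplicity `m₁` in `ℂ[Z]_{d₁}` and the type `μ` occurs with positive
   multiplicity `m₂` in `ℂ[Z]_{d₂}`, then the type `λ + μ` occurs with multiplicity at least
   `max(m₁, m₂)` in `ℂ[Z]_{d₁+d₂}`"; BIP 2019 Lemma 2.2 is the occurrence shadow, tree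
   `bip2019_lemma_2_2_holds`): multiplication by a nonzero highest-weight vector `y` of weight `ψ`
   is an injective linear map `HWV_χ → HWV_{χ+ψ}` of `k[Δ_m(f)]`, because `k[Δ_m(f)]` is an integral
   domain (`isDomain_orbitCoordRing`) and highest-weight vectors multiply
   (`mul_mem_highestWeightSpace_orbitCoordRep`). Here for EVERY infinite field (the route file
   `Summit.….NoValuativeFlip.orbitMultiplicity_le_add_of_hasHighestWeight` has `k = ℂ`).
4. `orbitMultiplicity_le_orbitMultiplicity_add_nsmul_single_top` — **outer monotonicity**: for every
nonzero form
   `f` of degree `m ≠ 0`, every weight `χ` and every `n`,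
   `mult_χ ≤ mult_{χ + n·(−m ε_top)}`, the weight of `X_{x_top^m}^n` (a highest-weight vector,
   `X_mem_highestWeightSpace_coordRep`, nonzero on the orbit by item 2). In partition language
   (`GL_{N²}` acting on `Sym^s k^{N×N}`, weights `λ^* = partitionWeightLex N λ`): if `λ` arises from
   `μ` by lengthening the first row by `s·n` (`μ = lowerTop λ (s n)`, BIP §2(a) "`λ♯D`"), then
   `mult_{μ^*} ≤ mult_{λ^*}` (`orbitMultiplicity_lowerTop_le`); for the cell: every certified row
   `r ≤ mult_{λ^*} ℂ[Δ(per₃)]_d` yields `r ≤ mult_{(λ₁+3n, λ₂, …)^*} ℂ[Δ(per₃)]_{d+n}` for all `n`,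
   and
   likewise on the determinant side.

5. `orbitMultiplicity_eq_plethysmCoeff_of_add_nsmul_single_top` /
   `orbitMultiplicity_lowerTop_eq_plethysmCoeff` — **fullness descends along first-row shortening** (characteristic zero): if the lengthened type
   is FULL (`mult = a`, no equation of that type) then so is the original type — the
   contrapositive of "equations propagate" (`orbitMultiplicity_add_lt_plethysmCoeff` of
   `HwvIdealProducts.lean`, Bürgisser–Ikenmeyer 2013 Prop. 3.3) with `a_{-m ε_top} ≥ 1`
   (`one_le_plethysmCoeff_single_top`). Census reading: a complete degree-`(d+1)` table of full
   types certifies every degree-`d` type whose first-row lengthening is full.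

6. `finrank_hwv_inf_orbitVanishingIdeal_le_add` (`_nsmul`, `_lowerTop_le`) — **highest-weight
   EQUATIONS propagate one for one**: for `a_ψ ≥ 1`,
   `dim (HWV_χ(k[Sym^m]) ∩ I(GL·f)) ≤ dim (HWV_{χ+ψ}(k[Sym^m]) ∩ I(GL·f))` — multiplication by a
   fixed nonzero highest-weight vector of weight `ψ` of the DOMAIN `k[Sym^m]` is injective and
   takes equations to equations (`mul_mem_hwv_inf_orbitVanishingIdeal`, `HwvIdealProducts.lean`);
   the counting form of the mechanism of Bürgisser–Ikenmeyer 2013 Prop. 3.3, of which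
   `orbitMultiplicity_add_lt_plethysmCoeff` is the one-equation shadow; equivalently the
   DEFICIENCY `a_χ − mult_χ` is nondecreasing along occurring weights
   (`plethysmCoeff_sub_orbitMultiplicity_le_add`); the ambient count itself is nondecreasing,
   `a_χ ≤ a_{χ+ψ}` (`plethysmCoeff_le_plethysmCoeff_add`; for `ψ = n·(−m ε_top)` this is the
   injectivity of the outer degree lifting map, BIP 2019 §4.4, Landsberg 2017 Thm. 8.9.1.1 after
   [Man97]).
7. `orbitMultiplicity_add_eq_of_plethysmCoeff_le` (`_nsmul`, `_nsmul_single_top`, `_lowerTop`) —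
   **transfer of EXACT closure data along an occurring weight of constant ambient multiplicity**
   (characteristic zero): if `ψ` occurs in `k[Δ_m(f)]` and `a_{χ+ψ} ≤ a_χ` (hence `= a_χ`), then
   `mult_{χ+ψ} k[Δ_m(f)] = mult_χ k[Δ_m(f)]` AND the equation counts agree
   (`finrank_hwv_inf_orbitVanishingIdeal_add_eq_of_plethysmCoeff_le`): squeeze item 3
   (`mult_χ ≤ mult_{χ+ψ}`) against item 6 (`#eq_χ ≤ #eq_{χ+ψ}`) through rank–nullity
   `mult + #eq = a` (`orbitMultiplicity_add_finrank_inf_eq_plethysmCoeff`, `HwvIdealRankBound.lean`).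
   With `ψ = n·(−m ε_{iₘ})` (item 4: occurs for EVERY nonzero form `f` of degree `m`) and in
   partition letters (`lowerTop`): if lengthening the first row of `μ` by `s·n` does not raise the
   plethysm coefficient, `a_{λ^*} ≤ a_{μ^*}`, then `mult_{λ^*} k[Δ_s(f)] = mult_{μ^*} k[Δ_s(f)]` and
   `#eq_{λ^*} = #eq_{μ^*}` — for `det_n`, the padded permanent, padded power sums, the Chow form,
   … at once. Item 5 is the special case `#eq_{λ^*} = 0`. This is the kernel form of the
   bookkeeping lemma "Q0" of the cell `pub-gct-max` (engine-2 / theory-1, 2026-08-23: "if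
   `a_λ(d[n]) = a_{λ⁻}((d−1)[n])` then … `mult_λ ℂ[X̄]_d = mult_{λ⁻} ℂ[X̄]_{d−1}` exactly for every
   such `X̄`"), an elementary corollary of the cited printed statements; the equality case itself
   was not found verbatim in print (corpus + galaxy searched 2026-08-23).
8. `plethysmCoeff_lowerTop_eq_of_stable`, `orbitMultiplicity_lowerTop_eq_of_stable`,
   `finrank_hwv_inf_orbitVanishingIdeal_lowerTop_eq_of_stable` — **the stable range** (over `ℂ`,
   `N × N` matrix variables, forms of degree `s`): BIP 2019 Prop. 5.8(2) (outer lifting SURJECTIVE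
   onto `HWV_{μ^*}` when `μ₂ + |μ̄| ≤ k' ≤ d`; tree `bip2019_prop_5_8_2_holds`) together with item 6
   gives the EQUALITY `a_{μ^*} = a_{ν^*}`, `ν = lowerTop μ (s(d − k'))`, and item 7 then freezes
   every closure datum: for each body `ρ` and every nonzero form `f` of degree `s`, the types
   `(ds − |ρ|, ρ)` with `d ≥ |ρ| + ρ₁` all have the same `mult` and the same `#eq` in `ℂ[Δ_s(f)]`
   — an explicit, printed stabilisation threshold for the degree profile of orbit-closure
   multiplicities (the cell's "LEMMA S + Q0(d)", here by theorem with threshold `|ρ| + ρ₁`).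

## References

* M. Bläser, C. Ikenmeyer, *Introduction to Geometric Complexity Theory*, Theory of Computing
  Graduate Surveys 10 (2025), Prop. 21.17 and Cor. 21.18 (p. 128). [BlaeserIkenmeyer2025]
* P. Bürgisser, C. Ikenmeyer, G. Panova, *No occurrence obstructions in geometric complexity
  theory*, J. AMS 32 (2019), Lemma 2.2, §4.4 (outer degree lifting), §5(c) Prop. 5.8(2), §6(a).
  [BurgisserIkenmeyerPanovaJAMS2019]
* P. Bürgisser, C. Ikenmeyer, *Explicit lower bounds via geometric complexity theory*, STOC 2013
  = arXiv:1210.8368, §3.3 Prop. 3.3. [BurgisserIkenmeyer2013]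
* J. M. Landsberg, *Geometry and Complexity Theory*, Cambridge Studies in Advanced Mathematics 169
  (2017), §8.9.1, Thm. 8.9.1.1 (p. 246: the outer degree lifting map is "injective and eventually"
  an isomorphism "on highest weight vectors … with `(p_2, …, p_v)` fixed and `p_1` growing").
  [LandsbergGCT2017]

## Mathlib and tree

Tree: `orbitVanishingIdeal_eq_ker_genericOrbitMap`, `aeval_genericOrbitMap`,
`isDomain_orbitCoordRing`
(`OrbitCoordinateRingProofs.lean`); `mul_mem_highestWeightSpace_orbitCoordRep`,
`X_mem_highestWeightSpace_coordRep`, `hasHighestWeight_orbitCoordRep_of_not_mem`, `topMatIdx`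
(`OccurrenceObstructionsBIP.lean`); `lowerTop`, `partitionWeightLex_lowerTop`
(`PlethysmStabilityBIP.lean`); `finiteDimensional_highestWeightSpace_orbitCoordRep_holds`
(`SchurWeylPlethysmOrbitWeightsProofs.lean`). Mathlib: `MvPolynomial.funext`,
`LinearMap.finrank_le_finrank_of_injective`.
-/

noncomputable section

open MvPolynomial

namespace Literature.Computability.AlgebraicComplexity

open _root_.Literature.NumberTheory.DiophantineGeometry
open _root_.Literature.Computability.Complexity

variable {σ k : Type*} [Fintype σ] [Field k]

/-! ### 1. Evaluation at a coordinate vector reads off the coefficient of a pure power -/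

section EvalSingle

variable [DecidableEq σ]

/-- For a form `h` of degree `m` and a coordinate vector `e_i`: `h(e_i) = coeff_{x_i^m} h` (every
other monomial of degree `m` contains a variable `x_j`, `j ≠ i`, which vanishes at `e_i`).
[folklore] -/
theorem eval_pi_single_one_of_isHomogeneous {h : MvPolynomial σ k} {m : ℕ}
    (hh : h.IsHomogeneous m) (i : σ) :
    eval (Pi.single i 1) h = coeff (Finsupp.single i m) h := by
  classical
  rw [eval_eq']
  rw [Finset.sum_eq_single (Finsupp.single i m)]
  · rw [Finset.prod_eq_single i]
    · simp
    · intro j _ hj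
      rw [Pi.single_eq_of_ne hj, Finsupp.single_eq_of_ne hj, pow_zero]
    · intro hi
      exact absurd (Finset.mem_univ i) hi
  · intro d hd hne
    by_cases hex : ∃ j, j ≠ i ∧ d j ≠ 0
    · obtain ⟨j, hji, hj⟩ := hex
      exact mul_eq_zero_of_right _
        (Finset.prod_eq_zero (Finset.mem_univ j) (by rw [Pi.single_eq_of_ne hji, zero_pow hj]))
    · push Not at hex
      have hd' : d = Finsupp.single i (d i) := Finsupp.ext fun j => by
        by_cases hji : j = i
        · subst hji; rw [Finsupp.single_eq_same]
        · rw [hex j hji, Finsupp.single_eq_of_ne hji]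
      have hdeg : d.degree ≠ m := by
        intro hdm
        rw [hd', Finsupp.degree_single] at hdm
        exact hne (hd'.trans (by rw [hdm]))
      rw [hh.coeff_eq_zero hdeg, zero_mul]
  · intro hnot
    rw [notMem_support_iff.mp hnot, zero_mul]

end EvalSingle

/-! ### 2. Coordinates of pure powers do not vanish on the orbit of a nonzero form -/

section PurePower

/-- Evaluating a linear substitute: `(A · f)(x) = f(l ↦ ∑_j A_{j l} x_j)`. [folklore] -/
theorem eval_linSubst_eq (A : Matrix σ σ k) (f : MvPolynomial σ k) (x : σ → k) :
    eval x (linSubst σ k A f) = eval (fun l => ∑ j, A j l * x j) f := by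
  rw [linSubst, aeval_eq_bind₁]
  change eval₂Hom (RingHom.id k) x (bind₁ _ f) = _
  rw [eval₂Hom_bind₁]
  change eval (fun l => eval x (∑ j, A j l • X j)) f = _
  have hfun : (fun l => eval x (∑ j, A j l • X j : MvPolynomial σ k)) = fun l => ∑ j, A j l * x j
      := by
    funext l
    simp [map_sum, smul_eval]
  rw [hfun]

/-- **The coordinate of a pure power `x_i^m` does not vanish on the orbit of a nonzero form `f` of
degree `m`** (over an infinite field): otherwise it would vanish at every `A · f`, `A` ANY matrix
(`orbitVanishingIdeal_eq_ker_genericOrbitMap`), but for the matrix all of whose rows equal a point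
`v` with `f(v) ≠ 0` the coefficient of `x_i^m` in `A · f` is `(A · f)(e_i) = f(v) ≠ 0`. BIP §6(a)
is the case `f = det_n` ("`X_1^n ∈ Ω_n` and … `⟨e_{11}^n, X_1^n⟩ = 1`"). [folklore] -/
theorem X_not_mem_orbitVanishingIdeal_of_eq_single [DecidableEq σ] [Infinite k]
    {f : MvPolynomial σ k} {m : ℕ} (hf : f.IsHomogeneous m) (hf0 : f ≠ 0) (i : σ)
    (e : DegIdx σ m) (he : e.1 = Finsupp.single i m) :
    (X e : MvPolynomial (DegIdx σ m) k) ∉ orbitVanishingIdeal f m := by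
  classical
  intro hmem
  -- a point where `f` does not vanish
  obtain ⟨v, hv⟩ : ∃ v : σ → k, eval v f ≠ 0 := by
    by_contra hcon
    push Not at hcon
    exact hf0 (MvPolynomial.funext fun x => by rw [hcon x, map_zero])
  -- the matrix all of whose rows are `v`
  set A : Matrix σ σ k := Matrix.of fun _ l => v l with hA
  have h := aeval_genericOrbitMap f m (X e) A
  rw [orbitVanishingIdeal_eq_ker_genericOrbitMap, RingHom.mem_ker] at hmem
  rw [hmem, map_zero, aeval_X, formCoeff_apply, he] at h
  have hev : eval (Pi.single i 1) (linSubst σ k A f) = eval v f := by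
    rw [eval_linSubst_eq]
    have hfun : (fun l => ∑ j, A j l * (Pi.single i 1 : σ → k) j) = v := by
      funext l
      simp only [hA, Matrix.of_apply]
      rw [Finset.sum_eq_single i (fun j _ hj => by rw [Pi.single_eq_of_ne hj, mul_zero])
        (fun hi => absurd (Finset.mem_univ i) hi), Pi.single_eq_same, mul_one]
    rw [hfun]
  rw [eval_pi_single_one_of_isHomogeneous (linSubst_isHomogeneous A hf) i, ← h] at hev
  exact hv hev.symm

end PurePower

/-! ### 3. The semigroup property of multiplicities -/

section Semigroup

variable [LinearOrder σ]

/-- **Semigroup property, multiplicity form** (Bläser–Ikenmeyer 2025, Prop. 21.17; the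
occurrence shadow is BIP 2019 Lemma 2.2): if `y ≠ 0` is a highest-weight vector of weight `ψ` in
`k[Δ_m(f)]`, then `mult_χ ≤ mult_{χ+ψ}` for every weight `χ` (`m ≠ 0`, `k` infinite).
Multiplication by `y` is an injective (`k[Δ_m(f)]` is a domain, `isDomain_orbitCoordRing`) linear
map `HWV_χ → HWV_{χ+ψ}` (`mul_mem_highestWeightSpace_orbitCoordRep`), and `HWV_{χ+ψ}` is
finite-dimensional (`finiteDimensional_highestWeightSpace_orbitCoordRep_holds`). Printed proof:
"`f F_1, ⋯, f F_{m₂}` are linearly independent HWVs of weight `λ + μ` … Since `ℂ[Z]` has no zero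
divisors". [cite: BlaeserIkenmeyer2025, Prop. 21.17 (p. 128)] -/
theorem orbitMultiplicity_le_orbitMultiplicity_add_of_ne_zero [Infinite k] (f : MvPolynomial σ k)
    {m : ℕ}
    (hm : m ≠ 0) (χ : Weight σ) {ψ : Weight σ} {y : OrbitCoordRing f m}
    (hy : y ∈ highestWeightSpace (orbitCoordRep f m) ψ) (hy0 : y ≠ 0) :
    orbitMultiplicity k f m χ ≤ orbitMultiplicity k f m (χ + ψ) := by
  classical
  haveI : IsDomain (OrbitCoordRing f m) := isDomain_orbitCoordRing f m
  haveI : FiniteDimensional k (highestWeightSpace (orbitCoordRep f m) (χ + ψ)) :=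
    finiteDimensional_highestWeightSpace_orbitCoordRep_holds f hm (χ + ψ)
  let L : highestWeightSpace (orbitCoordRep f m) χ →ₗ[k]
      highestWeightSpace (orbitCoordRep f m) (χ + ψ) :=
    { toFun := fun x => ⟨x.1 * y, mul_mem_highestWeightSpace_orbitCoordRep f m x.2 hy⟩
      map_add' := fun a b => by
        ext
        simp [add_mul]
      map_smul' := fun c a => by
        ext
        simp [smul_mul_assoc] }
  have hL : Function.Injective L := fun a b hab =>
    Subtype.ext (mul_right_cancel₀ hy0 (congrArg Subtype.val hab))
  exact LinearMap.finrank_le_finrank_of_injective hL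

/-- **Semigroup property, multiplicity form, with an occurring weight**: if `ψ` occurs in
`k[Δ_m(f)]` then `mult_χ ≤ mult_{χ+ψ}`. [cite: BlaeserIkenmeyer2025, Prop. 21.17 (p. 128)] -/
theorem orbitMultiplicity_le_orbitMultiplicity_add [Infinite k] (f : MvPolynomial σ k) {m : ℕ}
    (hm : m ≠ 0) (χ : Weight σ) {ψ : Weight σ} (hψ : HasHighestWeight (orbitCoordRep f m) ψ) :
    orbitMultiplicity k f m χ ≤ orbitMultiplicity k f m (χ + ψ) := by
  rw [hasHighestWeight_iff_exists] at hψ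
  obtain ⟨y, hy0, hy⟩ := hψ
  exact orbitMultiplicity_le_orbitMultiplicity_add_of_ne_zero f hm χ hy hy0

/-- Positive multiplicity is occurrence (the `finrank` of the zero submodule is `0`). [folklore] -/
theorem hasHighestWeight_orbitCoordRep_of_orbitMultiplicity_pos {f : MvPolynomial σ k} {m : ℕ}
    {χ : Weight σ} (h : 0 < orbitMultiplicity k f m χ) :
    HasHighestWeight (orbitCoordRep f m) χ := by
  intro hbot
  have h0 : orbitMultiplicity k f m χ = 0 := by
    rw [orbitMultiplicity, hwMultiplicity]
    change Module.finrank k ↥(highestWeightSpace (orbitCoordRep f m) χ) = 0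
    rw [hbot, finrank_bot]
  omega

/-- Occurrence is positive multiplicity (`m ≠ 0`, `k` infinite: the highest-weight space is
finite-dimensional). [folklore] -/
theorem orbitMultiplicity_pos_of_hasHighestWeight [Infinite k] (f : MvPolynomial σ k) {m : ℕ}
    (hm : m ≠ 0) {χ : Weight σ} (h : HasHighestWeight (orbitCoordRep f m) χ) :
    0 < orbitMultiplicity k f m χ := by
  classical
  haveI : FiniteDimensional k (highestWeightSpace (orbitCoordRep f m) χ) :=
    finiteDimensional_highestWeightSpace_orbitCoordRep_holds f hm χ
  rw [hasHighestWeight_iff_exists] at h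
  obtain ⟨y, hy0, hy⟩ := h
  rw [orbitMultiplicity, hwMultiplicity]
  change 0 < Module.finrank k ↥(highestWeightSpace (orbitCoordRep f m) χ)
  rw [Module.finrank_pos_iff_exists_ne_zero]
  exact ⟨⟨y, hy⟩, fun h => hy0 (congrArg Subtype.val h)⟩

/-- `mult_χ > 0 ⇔ χ` occurs (`m ≠ 0`, `k` infinite). [folklore] -/
theorem orbitMultiplicity_pos_iff_hasHighestWeight [Infinite k] (f : MvPolynomial σ k) {m : ℕ}
    (hm : m ≠ 0) (χ : Weight σ) :
    0 < orbitMultiplicity k f m χ ↔ HasHighestWeight (orbitCoordRep f m) χ :=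
  ⟨hasHighestWeight_orbitCoordRep_of_orbitMultiplicity_pos,
    orbitMultiplicity_pos_of_hasHighestWeight f hm⟩

/-- **Bläser–Ikenmeyer Prop. 21.17 as printed** (both multiplicities positive ⇒ the sum weight has
multiplicity at least the maximum). [cite: BlaeserIkenmeyer2025, Prop. 21.17 (p. 128)] -/
theorem max_orbitMultiplicity_le_orbitMultiplicity_add [Infinite k] (f : MvPolynomial σ k) {m : ℕ}
    (hm : m ≠ 0)
    {χ ψ : Weight σ} (hχ : 0 < orbitMultiplicity k f m χ) (hψ : 0 < orbitMultiplicity k f m ψ) :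
    max (orbitMultiplicity k f m χ) (orbitMultiplicity k f m ψ) ≤
      orbitMultiplicity k f m (χ + ψ) := by
  refine max_le ?_ ?_
  · exact orbitMultiplicity_le_orbitMultiplicity_add f hm χ
      (hasHighestWeight_orbitCoordRep_of_orbitMultiplicity_pos hψ)
  · rw [add_comm]
    exact orbitMultiplicity_le_orbitMultiplicity_add f hm ψ
      (hasHighestWeight_orbitCoordRep_of_orbitMultiplicity_pos hχ)

/-- In particular positive multiplicities add to a positive multiplicity (BIP Lemma 2.2 in
multiplicity letters). [cite: BurgisserIkenmeyerPanovaJAMS2019, Lemma 2.2] -/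
theorem orbitMultiplicity_add_pos [Infinite k] (f : MvPolynomial σ k) {m : ℕ} (hm : m ≠ 0)
    {χ ψ : Weight σ} (hχ : 0 < orbitMultiplicity k f m χ) (hψ : 0 < orbitMultiplicity k f m ψ) :
    0 < orbitMultiplicity k f m (χ + ψ) :=
  lt_of_lt_of_le (lt_max_of_lt_left hχ) (max_orbitMultiplicity_le_orbitMultiplicity_add f hm hχ hψ)

/-- **Iterated form**: `mult_χ ≤ mult_{χ + n • ψ}` for every `n`, whenever `ψ` occurs.
[cite: BlaeserIkenmeyer2025, Prop. 21.17 (p. 128)] -/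
theorem orbitMultiplicity_le_orbitMultiplicity_add_nsmul [Infinite k] (f : MvPolynomial σ k)
    {m : ℕ} (hm : m ≠ 0) (χ : Weight σ) {ψ : Weight σ}
    (hψ : HasHighestWeight (orbitCoordRep f m) ψ) (n : ℕ) :
    orbitMultiplicity k f m χ ≤ orbitMultiplicity k f m (χ + n • ψ) := by
  induction n with
  | zero => simp
  | succ n ih =>
    refine ih.trans ?_
    have h := orbitMultiplicity_le_orbitMultiplicity_add f hm (χ + n • ψ) hψ
    rwa [add_assoc, ← succ_nsmul] at h

end Semigroup

/-! ### 4. Outer monotonicity: lengthening the first row never lowers the multiplicity -/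

section Outer

variable [LinearOrder σ]

/-- **The weight of the top pure power occurs in `k[Δ_m(f)]`** for every nonzero form `f` of
degree `m` (`iₘ` the greatest variable): `X_{x_{iₘ}^m}` is a highest-weight vector of weight
`-m ε_{iₘ}` (`X_mem_highestWeightSpace_coordRep`) that does not vanish on the orbit
(`X_not_mem_orbitVanishingIdeal_of_eq_single`). BIP §6(a) for `f = det_n`.
[cite: BurgisserIkenmeyerPanovaJAMS2019, §6(a)] -/
theorem hasHighestWeight_orbitCoordRep_single_top [Infinite k] {f : MvPolynomial σ k} {m : ℕ}
    (hf : f.IsHomogeneous m) (hf0 : f ≠ 0) (iₘ : σ) (hiₘ : ∀ i, i ≤ iₘ) :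
    HasHighestWeight (orbitCoordRep f m) (Pi.single iₘ (-(m : ℤ))) := by
  classical
  let e : DegIdx σ m := ⟨Finsupp.single iₘ m, mem_degMonomials_iff.mpr (Finsupp.degree_single _ _)⟩
  exact hasHighestWeight_orbitCoordRep_of_not_mem f m
    (X_mem_highestWeightSpace_coordRep (k := k) m iₘ hiₘ e rfl)
    (X_not_mem_orbitVanishingIdeal_of_eq_single hf hf0 iₘ e rfl)

/-- **Outer monotonicity of orbit-closure multiplicities**: for every nonzero form `f` of degree
`m ≠ 0` over an infinite field, every weight `χ` and every `n`,
`mult_χ k[Δ_m(f)] ≤ mult_{χ + n·(-m ε_{iₘ})} k[Δ_m(f)]` — multiplication by `X_{x_{iₘ}^m}^n`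
(semigroup property with the occurring weight of `hasHighestWeight_orbitCoordRep_single_top`).
[cite: BlaeserIkenmeyer2025, Prop. 21.17 (p. 128)] -/
theorem orbitMultiplicity_le_orbitMultiplicity_add_nsmul_single_top [Infinite k] {f : MvPolynomial
    σ k} {m : ℕ}
    (hm : m ≠ 0) (hf : f.IsHomogeneous m) (hf0 : f ≠ 0) (iₘ : σ) (hiₘ : ∀ i, i ≤ iₘ)
    (χ : Weight σ) (n : ℕ) :
    orbitMultiplicity k f m χ ≤ orbitMultiplicity k f m (χ + n • Pi.single iₘ (-(m : ℤ))) :=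
  orbitMultiplicity_le_orbitMultiplicity_add_nsmul f hm χ
    (hasHighestWeight_orbitCoordRep_single_top hf hf0 iₘ hiₘ) n

/-- **Partition form (lengthening the first row).** `GL_{N²}` acting on forms of degree `s ≠ 0`
in the `N × N` matrix variables, weights `λ^* = partitionWeightLex N λ`: if `λ ⊢ D` has
`λ₂ + s n ≤ λ₁` and `μ = lowerTop λ (s n) ⊢ D'` (`D' + s n = D`) is `λ` with its first row
shortened by `s n` — so `λ = μ♯D` arises from `μ` by lengthening the first row, BIP §2(a) — then
`mult_{μ^*} k[Δ_s(f)] ≤ mult_{λ^*} k[Δ_s(f)]` for every nonzero form `f` of degree `s`: the weights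
differ by the weight of `X_{x_top^s}^n` (`partitionWeightLex_lowerTop`). For the cell (`N = s = 3`,
`f = per₃` or `det₃`): a certified bound `r ≤ mult_{(9,9,2⁶)^*} ℂ[Δ(per₃)]_{10}` gives
`r ≤ mult_{(9+3n,9,2⁶)^*} ℂ[Δ(per₃)]_{10+n}` for all `n`.
[cite: BlaeserIkenmeyer2025, Prop. 21.17 (p. 128)] -/
theorem orbitMultiplicity_lowerTop_le [Infinite k] {N s : ℕ} [NeZero N]
    {f : MvPolynomial (MatIdx N) k} (hs : s ≠ 0) (hf : f.IsHomogeneous s) (hf0 : f ≠ 0)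
    {D D' : ℕ} (lam : Nat.Partition D) (n : ℕ) (hD : D' + s * n = D)
    (hr : secondPart lam + s * n ≤ lam.parts.sup) :
    orbitMultiplicity k f s (partitionWeightLex N (lowerTop lam (s * n) D' hD hr)) ≤
      orbitMultiplicity k f s (partitionWeightLex N lam) := by
  have h := orbitMultiplicity_le_orbitMultiplicity_add_nsmul_single_top hs hf hf0 (topMatIdx N)
      (le_topMatIdx N)
    (partitionWeightLex N (lowerTop lam (s * n) D' hD hr)) n
  have hw : partitionWeightLex N (lowerTop lam (s * n) D' hD hr) +
      n • (Pi.single (topMatIdx N) (-(s : ℤ)) : Weight (MatIdx N)) = partitionWeightLex N lam := by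
    rw [partitionWeightLex_lowerTop, add_assoc, ← Pi.single_smul, ← Pi.single_add]
    conv_rhs => rw [← add_zero (partitionWeightLex N lam)]
    congr 1
    rw [← Pi.single_zero (topMatIdx N)]
    congr 1
    push_cast
    rw [smul_neg, nsmul_eq_mul]
    ring
  rwa [hw] at h

end Outer

/-! ### 5. Fullness descends along first-row shortening -/

section Fullness

variable [LinearOrder σ]

/-- The weight `-m ε_{iₘ}` of the top pure power occurs in `k[Sym^m (k^σ)]`: `a_{-m ε_{iₘ}} ≥ 1`
(`X_{x_{iₘ}^m}` is a nonzero highest-weight vector of that weight; `m ≠ 0`, `k` infinite so that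
the highest-weight space is finite-dimensional). [cite: BurgisserIkenmeyerPanovaJAMS2019, §6(a)] -/
theorem one_le_plethysmCoeff_single_top [Infinite k] {m : ℕ} (hm : m ≠ 0) (iₘ : σ)
    (hiₘ : ∀ i, i ≤ iₘ) : 1 ≤ plethysmCoeff k σ m (Pi.single iₘ (-(m : ℤ))) := by
  classical
  haveI := finiteDimensional_highestWeightSpace_coordRep_holds (k := k) (σ := σ) hm
    (Pi.single iₘ (-(m : ℤ)))
  let e : DegIdx σ m := ⟨Finsupp.single iₘ m, mem_degMonomials_iff.mpr (Finsupp.degree_single _ _)⟩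
  have hX := X_mem_highestWeightSpace_coordRep (k := k) m iₘ hiₘ e rfl
  rw [plethysmCoeff, hwMultiplicity, Nat.one_le_iff_ne_zero, Ne, Submodule.finrank_eq_zero]
  intro hbot
  rw [hbot, Submodule.mem_bot] at hX
  exact X_ne_zero e hX

/-- **Fullness descends along first-row shortening** (characteristic zero, `f` a form of degree
`m ≠ 0`, `iₘ` the greatest variable): if the type `χ + n·(-m ε_{iₘ})` is full in `k[Δ_m(f)]`
(`mult = a`: no highest-weight equation of that type), then `χ` is full. Contrapositive of the
propagation of equations `mult_χ < a_χ ⇒ mult_{χ+ψ} < a_{χ+ψ}` for `a_ψ ≥ 1`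
(`orbitMultiplicity_add_lt_plethysmCoeff`, Bürgisser–Ikenmeyer 2013 Prop. 3.3) with
`ψ = -m ε_{iₘ}` (`one_le_plethysmCoeff_single_top`) and `mult ≤ a`
(`orbitMultiplicity_le_plethysmCoeff_holds`). [cite: BurgisserIkenmeyer2013, §3.3 Prop. 3.3] -/
theorem orbitMultiplicity_eq_plethysmCoeff_of_add_nsmul_single_top [CharZero k]
    {f : MvPolynomial σ k} {m : ℕ} (hm : m ≠ 0) (hf : f.IsHomogeneous m) (iₘ : σ)
    (hiₘ : ∀ i, i ≤ iₘ) (χ : Weight σ) (n : ℕ)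
    (hfull : orbitMultiplicity k f m (χ + n • Pi.single iₘ (-(m : ℤ))) =
      plethysmCoeff k σ m (χ + n • Pi.single iₘ (-(m : ℤ)))) :
    orbitMultiplicity k f m χ = plethysmCoeff k σ m χ := by
  haveI : Infinite k := CharZero.infinite k
  by_contra hne
  have hlt : orbitMultiplicity k f m χ < plethysmCoeff k σ m χ :=
    lt_of_le_of_ne (orbitMultiplicity_le_plethysmCoeff_holds (k := k) f hm hf χ) hne
  have hψ := one_le_plethysmCoeff_single_top (k := k) hm iₘ hiₘ
  have key : ∀ j : ℕ, orbitMultiplicity k f m (χ + j • Pi.single iₘ (-(m : ℤ))) <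
      plethysmCoeff k σ m (χ + j • Pi.single iₘ (-(m : ℤ))) := by
    intro j
    induction j with
    | zero => simpa using hlt
    | succ j ih =>
      have h := orbitMultiplicity_add_lt_plethysmCoeff hm ih hψ
      rwa [add_assoc, ← succ_nsmul] at h
  exact (key n).ne hfull

/-- The weight bookkeeping of first-row shortening: `(lowerTop λ (s n))^* + n·(-s ε_top) = λ^*`.
[cite: BurgisserIkenmeyerPanovaJAMS2019, Lemma 5.3] -/
theorem partitionWeightLex_lowerTop_add_nsmul_single {N s : ℕ} [NeZero N] {D D' : ℕ}
    (lam : Nat.Partition D) (n : ℕ) (hD : D' + s * n = D)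
    (hr : secondPart lam + s * n ≤ lam.parts.sup) :
    partitionWeightLex N (lowerTop lam (s * n) D' hD hr) +
        n • (Pi.single (topMatIdx N) (-(s : ℤ)) : Weight (MatIdx N)) =
      partitionWeightLex N lam := by
  rw [partitionWeightLex_lowerTop, add_assoc, ← Pi.single_smul, ← Pi.single_add]
  conv_rhs => rw [← add_zero (partitionWeightLex N lam)]
  congr 1
  rw [← Pi.single_zero (topMatIdx N)]
  congr 1
  push_cast
  rw [smul_neg, nsmul_eq_mul]
  ring

/-- **Partition form of descent.** `GL_{N²}` on forms of degree `s ≠ 0` in the matrix variables,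
characteristic zero: if `λ` (with `λ₂ + s n ≤ λ₁`) is a FULL type of `k[Δ_s(f)]`
(`mult_{λ^*} = a_{λ^*}`), then its first-row shortening `μ = lowerTop λ (s n)` is full. For the
cell (`N = s = 3`): a complete all-full table in degree `d + 1` certifies, by theorem, every
degree-`d` type whose lengthening `(λ₁ + 3, λ₂, …)` is full there.
[cite: BurgisserIkenmeyer2013, §3.3 Prop. 3.3] -/
theorem orbitMultiplicity_lowerTop_eq_plethysmCoeff [CharZero k] {N s : ℕ} [NeZero N]
    {f : MvPolynomial (MatIdx N) k} (hs : s ≠ 0) (hf : f.IsHomogeneous s) {D D' : ℕ}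
    (lam : Nat.Partition D) (n : ℕ) (hD : D' + s * n = D)
    (hr : secondPart lam + s * n ≤ lam.parts.sup)
    (hfull : orbitMultiplicity k f s (partitionWeightLex N lam) =
      plethysmCoeff k (MatIdx N) s (partitionWeightLex N lam)) :
    orbitMultiplicity k f s (partitionWeightLex N (lowerTop lam (s * n) D' hD hr)) =
      plethysmCoeff k (MatIdx N) s (partitionWeightLex N (lowerTop lam (s * n) D' hD hr)) := by
  refine orbitMultiplicity_eq_plethysmCoeff_of_add_nsmul_single_top hs hf (topMatIdx N)
    (le_topMatIdx N) _ n ?_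
  rwa [partitionWeightLex_lowerTop_add_nsmul_single lam n hD hr]

end Fullness

/-! ### 6. Equations propagate one for one; ambient and deficiency monotonicity -/

section Propagation

variable [LinearOrder σ]

/-- **Ambient multiplicities never decrease along an occurring weight**: if `a_ψ ≥ 1` then
`a_χ ≤ a_{χ+ψ}` (`m ≠ 0`, `k` infinite). Multiplication by a fixed nonzero highest-weight vector
`G` of weight `ψ` of the polynomial ring `k[Sym^m (k^σ)]` — a domain — is an injective linear map
`HWV_χ(k[Sym^m]) → HWV_{χ+ψ}(k[Sym^m])` (`mul_mem_highestWeightSpace_coordRep`). For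
`ψ = (d−k)·(m ε)` (multiplication by `(X_1^m)^{d−k}`) this is the injectivity of the outer degree
lifting map of BIP 2019 §4.4, "we obtain the injective linear map
`Sym^k Sym^m V → Sym^d Sym^m V, f ↦ (X_1^m)^{d−k} · f` … maps a highest weight vector of weight `ν`
to a highest weight vector of weight `ν + ((d−k)m)`"; Landsberg 2017 Thm. 8.9.1.1.
[cite: BurgisserIkenmeyerPanovaJAMS2019, §4.4] -/
theorem plethysmCoeff_le_plethysmCoeff_add [Infinite k] {m : ℕ} (hm : m ≠ 0) (χ : Weight σ)
    {ψ : Weight σ} (hψ : 1 ≤ plethysmCoeff k σ m ψ) :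
    plethysmCoeff k σ m χ ≤ plethysmCoeff k σ m (χ + ψ) := by
  classical
  haveI : FiniteDimensional k (highestWeightSpace (coordRep σ k m) (χ + ψ)) :=
    finiteDimensional_highestWeightSpace_coordRep_holds hm (χ + ψ)
  obtain ⟨G, hG0, hG⟩ := exists_hwv_ne_zero_of_plethysmCoeff_pos (k := k) hψ
  let L : ↥(highestWeightSpace (coordRep σ k m) χ) →ₗ[k]
      ↥(highestWeightSpace (coordRep σ k m) (χ + ψ)) :=
    { toFun := fun x => ⟨x.1 * G, mul_mem_highestWeightSpace_coordRep x.2 hG⟩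
      map_add' := fun a b => by
        ext
        simp [add_mul]
      map_smul' := fun c a => by
        ext
        simp }
  have hL : Function.Injective L := fun a b hab =>
    Subtype.ext (mul_right_cancel₀ hG0 (congrArg Subtype.val hab))
  exact LinearMap.finrank_le_finrank_of_injective hL

/-- Iterated form: `a_χ ≤ a_{χ + n•ψ}` for `a_ψ ≥ 1`. [cite: BurgisserIkenmeyerPanovaJAMS2019, §4.4] -/
theorem plethysmCoeff_le_plethysmCoeff_add_nsmul [Infinite k] {m : ℕ} (hm : m ≠ 0) (χ : Weight σ)
    {ψ : Weight σ} (hψ : 1 ≤ plethysmCoeff k σ m ψ) (n : ℕ) :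
    plethysmCoeff k σ m χ ≤ plethysmCoeff k σ m (χ + n • ψ) := by
  induction n with
  | zero => rw [zero_nsmul, add_zero]
  | succ n ih =>
    refine ih.trans ?_
    have h := plethysmCoeff_le_plethysmCoeff_add (k := k) hm (χ + n • ψ) hψ
    rwa [add_assoc, ← succ_nsmul] at h

/-- **Highest-weight equations propagate one for one.** For a form `f`, `m ≠ 0`, `k` infinite,
and weights `χ, ψ` with `a_ψ ≥ 1`:
`dim (HWV_χ(k[Sym^m]) ∩ I(GL · f)) ≤ dim (HWV_{χ+ψ}(k[Sym^m]) ∩ I(GL · f))`. Multiplication by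
a fixed nonzero highest-weight vector `G` of weight `ψ` of the domain `k[Sym^m (k^σ)]` is
injective and takes weight-`χ` equations to weight-`(χ+ψ)` equations
(`mul_mem_hwv_inf_orbitVanishingIdeal`: the vanishing ideal is an ideal and a graded
`GL`-subrepresentation). This is the counting form of the mechanism of Bürgisser–Ikenmeyer 2013,
§3.3 Prop. 3.3 (proof: the vanishing ideal of an orbit closure "is a graded `G`-submodule"),
whose one-equation shadow is `orbitMultiplicity_add_lt_plethysmCoeff` (`HwvIdealProducts.lean`).
[cite: BurgisserIkenmeyer2013, §3.3 Prop. 3.3] -/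
theorem finrank_hwv_inf_orbitVanishingIdeal_le_add [Infinite k] (f : MvPolynomial σ k) {m : ℕ}
    (hm : m ≠ 0) (χ : Weight σ) {ψ : Weight σ} (hψ : 1 ≤ plethysmCoeff k σ m ψ) :
    Module.finrank k ↥(highestWeightSpace (coordRep σ k m) χ ⊓
        (orbitVanishingIdeal f m).restrictScalars k) ≤
      Module.finrank k ↥(highestWeightSpace (coordRep σ k m) (χ + ψ) ⊓
        (orbitVanishingIdeal f m).restrictScalars k) := by
  classical
  haveI : FiniteDimensional k (highestWeightSpace (coordRep σ k m) (χ + ψ)) :=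
    finiteDimensional_highestWeightSpace_coordRep_holds hm (χ + ψ)
  haveI : FiniteDimensional k ↥(highestWeightSpace (coordRep σ k m) (χ + ψ) ⊓
      (orbitVanishingIdeal f m).restrictScalars k) :=
    Submodule.finiteDimensional_of_le inf_le_left
  obtain ⟨G, hG0, hG⟩ := exists_hwv_ne_zero_of_plethysmCoeff_pos (k := k) hψ
  let L : ↥(highestWeightSpace (coordRep σ k m) χ ⊓ (orbitVanishingIdeal f m).restrictScalars k)
      →ₗ[k] ↥(highestWeightSpace (coordRep σ k m) (χ + ψ) ⊓
        (orbitVanishingIdeal f m).restrictScalars k) :=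
    { toFun := fun x =>
        ⟨x.1 * G, mul_mem_hwv_inf_orbitVanishingIdeal (f := f) x.2.1 x.2.2 hG⟩
      map_add' := fun a b => by
        ext
        simp [add_mul]
      map_smul' := fun c a => by
        ext
        simp }
  have hL : Function.Injective L := fun a b hab =>
    Subtype.ext (mul_right_cancel₀ hG0 (congrArg Subtype.val hab))
  exact LinearMap.finrank_le_finrank_of_injective hL

/-- Iterated form: `#eq_χ ≤ #eq_{χ + n•ψ}` for `a_ψ ≥ 1`.
[cite: BurgisserIkenmeyer2013, §3.3 Prop. 3.3] -/
theorem finrank_hwv_inf_orbitVanishingIdeal_le_add_nsmul [Infinite k] (f : MvPolynomial σ k)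
    {m : ℕ} (hm : m ≠ 0) (χ : Weight σ) {ψ : Weight σ} (hψ : 1 ≤ plethysmCoeff k σ m ψ) (n : ℕ) :
    Module.finrank k ↥(highestWeightSpace (coordRep σ k m) χ ⊓
        (orbitVanishingIdeal f m).restrictScalars k) ≤
      Module.finrank k ↥(highestWeightSpace (coordRep σ k m) (χ + n • ψ) ⊓
        (orbitVanishingIdeal f m).restrictScalars k) := by
  induction n with
  | zero => rw [zero_nsmul, add_zero]
  | succ n ih =>
    refine ih.trans ?_
    have h := finrank_hwv_inf_orbitVanishingIdeal_le_add f hm (χ + n • ψ) hψ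
    rwa [add_assoc, ← succ_nsmul] at h

/-- **Deficiency monotonicity**: for `a_ψ ≥ 1`, `a_χ − mult_χ ≤ a_{χ+ψ} − mult_{χ+ψ}` in
`k[Δ_m(f)]` (`m ≠ 0`, characteristic zero) — the number of independent highest-weight equations
of an orbit closure never decreases along an occurring weight (rank–nullity
`mult + #eq = a`, `orbitMultiplicity_add_finrank_inf_eq_plethysmCoeff`, with
`finrank_hwv_inf_orbitVanishingIdeal_le_add`). [cite: BurgisserIkenmeyer2013, §3.3 Prop. 3.3] -/
theorem plethysmCoeff_sub_orbitMultiplicity_le_add [CharZero k] (f : MvPolynomial σ k) {m : ℕ}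
    (hm : m ≠ 0) (χ : Weight σ) {ψ : Weight σ} (hψ : 1 ≤ plethysmCoeff k σ m ψ) :
    plethysmCoeff k σ m χ - orbitMultiplicity k f m χ ≤
      plethysmCoeff k σ m (χ + ψ) - orbitMultiplicity k f m (χ + ψ) := by
  haveI : Infinite k := CharZero.infinite k
  have h₁ := orbitMultiplicity_add_finrank_inf_eq_plethysmCoeff f hm χ
  have h₂ := orbitMultiplicity_add_finrank_inf_eq_plethysmCoeff f hm (χ + ψ)
  have h₃ := finrank_hwv_inf_orbitVanishingIdeal_le_add f hm χ hψ
  omega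

/-- A weight occurring in the quotient `k[Δ_m(f)]` occurs in `k[Sym^m]`: `a_ψ ≥ 1`
(`0 < mult_ψ ≤ a_ψ` by rank–nullity; `m ≠ 0`, characteristic zero).
[cite: DorflerIkenmeyerPanova2020, §5] -/
theorem one_le_plethysmCoeff_of_hasHighestWeight_orbitCoordRep [CharZero k] (f : MvPolynomial σ k)
    {m : ℕ} (hm : m ≠ 0) {ψ : Weight σ} (hψ : HasHighestWeight (orbitCoordRep f m) ψ) :
    1 ≤ plethysmCoeff k σ m ψ := by
  haveI : Infinite k := CharZero.infinite k
  have h := orbitMultiplicity_add_finrank_inf_eq_plethysmCoeff f hm ψ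
  have hpos := orbitMultiplicity_pos_of_hasHighestWeight f hm hψ
  omega

end Propagation

/-! ### 7. Transfer of exact multiplicities along an occurring weight of constant ambient multiplicity -/

section Transfer

variable [LinearOrder σ]

/-- **Transfer of exact multiplicities (the cell's LEMMA Q0, kernel form).** `f` a form,
`m ≠ 0`, characteristic zero. If `ψ` OCCURS in `k[Δ_m(f)]` and lengthening by `ψ` does not raise
the ambient multiplicity, `a_{χ+ψ} ≤ a_χ` (so `a_{χ+ψ} = a_χ`, `plethysmCoeff_le_plethysmCoeff_add`),
then `mult_{χ+ψ} k[Δ_m(f)] = mult_χ k[Δ_m(f)]`: squeeze the semigroup inequality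
`mult_χ ≤ mult_{χ+ψ}` (Bläser–Ikenmeyer Prop. 21.17, `orbitMultiplicity_le_orbitMultiplicity_add`)
against `#eq_χ ≤ #eq_{χ+ψ}` (`finrank_hwv_inf_orbitVanishingIdeal_le_add`) through rank–nullity
`mult + #eq = a`. An elementary corollary of the cited statements, recorded for the scan
bookkeeping of the cell `pub-gct-max` (closure data of a type are inherited EXACTLY from its
first-row shortening whenever the plethysm coefficient is).
[cite: BlaeserIkenmeyer2025, Prop. 21.17 (p. 128)] -/
theorem orbitMultiplicity_add_eq_of_plethysmCoeff_le [CharZero k] (f : MvPolynomial σ k) {m : ℕ}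
    (hm : m ≠ 0) (χ : Weight σ) {ψ : Weight σ} (hψ : HasHighestWeight (orbitCoordRep f m) ψ)
    (ha : plethysmCoeff k σ m (χ + ψ) ≤ plethysmCoeff k σ m χ) :
    orbitMultiplicity k f m (χ + ψ) = orbitMultiplicity k f m χ := by
  haveI : Infinite k := CharZero.infinite k
  have hψ1 := one_le_plethysmCoeff_of_hasHighestWeight_orbitCoordRep f hm hψ
  have hmono := orbitMultiplicity_le_orbitMultiplicity_add f hm χ hψ
  have h₁ := orbitMultiplicity_add_finrank_inf_eq_plethysmCoeff f hm χ
  have h₂ := orbitMultiplicity_add_finrank_inf_eq_plethysmCoeff f hm (χ + ψ)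
  have h₃ := finrank_hwv_inf_orbitVanishingIdeal_le_add f hm χ hψ1
  omega

/-- … and under the same hypotheses the EQUATION COUNTS agree:
`dim (HWV_{χ+ψ} ∩ I(GL·f)) = dim (HWV_χ ∩ I(GL·f))`.
[cite: BurgisserIkenmeyer2013, §3.3 Prop. 3.3] -/
theorem finrank_hwv_inf_orbitVanishingIdeal_add_eq_of_plethysmCoeff_le [CharZero k]
    (f : MvPolynomial σ k) {m : ℕ} (hm : m ≠ 0) (χ : Weight σ) {ψ : Weight σ}
    (hψ : HasHighestWeight (orbitCoordRep f m) ψ)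
    (ha : plethysmCoeff k σ m (χ + ψ) ≤ plethysmCoeff k σ m χ) :
    Module.finrank k ↥(highestWeightSpace (coordRep σ k m) (χ + ψ) ⊓
        (orbitVanishingIdeal f m).restrictScalars k) =
      Module.finrank k ↥(highestWeightSpace (coordRep σ k m) χ ⊓
        (orbitVanishingIdeal f m).restrictScalars k) := by
  haveI : Infinite k := CharZero.infinite k
  have hψ1 := one_le_plethysmCoeff_of_hasHighestWeight_orbitCoordRep f hm hψ
  have hmono := orbitMultiplicity_le_orbitMultiplicity_add f hm χ hψ
  have h₁ := orbitMultiplicity_add_finrank_inf_eq_plethysmCoeff f hm χ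
  have h₂ := orbitMultiplicity_add_finrank_inf_eq_plethysmCoeff f hm (χ + ψ)
  have h₃ := finrank_hwv_inf_orbitVanishingIdeal_le_add f hm χ hψ1
  omega

/-- **Iterated transfer**: if `ψ` occurs in `k[Δ_m(f)]` and `a_{χ + n•ψ} ≤ a_χ` then
`mult_{χ + n•ψ} = mult_χ` (characteristic zero, `m ≠ 0`).
[cite: BlaeserIkenmeyer2025, Prop. 21.17 (p. 128)] -/
theorem orbitMultiplicity_add_nsmul_eq_of_plethysmCoeff_le [CharZero k] (f : MvPolynomial σ k)
    {m : ℕ} (hm : m ≠ 0) (χ : Weight σ) {ψ : Weight σ}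
    (hψ : HasHighestWeight (orbitCoordRep f m) ψ) (n : ℕ)
    (ha : plethysmCoeff k σ m (χ + n • ψ) ≤ plethysmCoeff k σ m χ) :
    orbitMultiplicity k f m (χ + n • ψ) = orbitMultiplicity k f m χ := by
  haveI : Infinite k := CharZero.infinite k
  have hψ1 := one_le_plethysmCoeff_of_hasHighestWeight_orbitCoordRep f hm hψ
  have hmono := orbitMultiplicity_le_orbitMultiplicity_add_nsmul f hm χ hψ n
  have h₁ := orbitMultiplicity_add_finrank_inf_eq_plethysmCoeff f hm χ
  have h₂ := orbitMultiplicity_add_finrank_inf_eq_plethysmCoeff f hm (χ + n • ψ)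
  have h₃ := finrank_hwv_inf_orbitVanishingIdeal_le_add_nsmul f hm χ hψ1 n
  omega

/-- Iterated transfer, equation counts. [cite: BurgisserIkenmeyer2013, §3.3 Prop. 3.3] -/
theorem finrank_hwv_inf_orbitVanishingIdeal_add_nsmul_eq_of_plethysmCoeff_le [CharZero k]
    (f : MvPolynomial σ k) {m : ℕ} (hm : m ≠ 0) (χ : Weight σ) {ψ : Weight σ}
    (hψ : HasHighestWeight (orbitCoordRep f m) ψ) (n : ℕ)
    (ha : plethysmCoeff k σ m (χ + n • ψ) ≤ plethysmCoeff k σ m χ) :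
    Module.finrank k ↥(highestWeightSpace (coordRep σ k m) (χ + n • ψ) ⊓
        (orbitVanishingIdeal f m).restrictScalars k) =
      Module.finrank k ↥(highestWeightSpace (coordRep σ k m) χ ⊓
        (orbitVanishingIdeal f m).restrictScalars k) := by
  haveI : Infinite k := CharZero.infinite k
  have hψ1 := one_le_plethysmCoeff_of_hasHighestWeight_orbitCoordRep f hm hψ
  have hmono := orbitMultiplicity_le_orbitMultiplicity_add_nsmul f hm χ hψ n
  have h₁ := orbitMultiplicity_add_finrank_inf_eq_plethysmCoeff f hm χ
  have h₂ := orbitMultiplicity_add_finrank_inf_eq_plethysmCoeff f hm (χ + n • ψ)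
  have h₃ := finrank_hwv_inf_orbitVanishingIdeal_le_add_nsmul f hm χ hψ1 n
  omega

/-- **Transfer along the first row, weight form.** For EVERY nonzero form `f` of degree `m ≠ 0`
(characteristic zero; `iₘ` the greatest variable, so that `X_{x_{iₘ}^m}` occurs in `k[Δ_m(f)]`,
`hasHighestWeight_orbitCoordRep_single_top`): if `a_{χ + n·(−m ε_{iₘ})} ≤ a_χ` then
`mult_{χ + n·(−m ε_{iₘ})} k[Δ_m(f)] = mult_χ k[Δ_m(f)]`.
[cite: BlaeserIkenmeyer2025, Prop. 21.17 (p. 128)] -/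
theorem orbitMultiplicity_add_nsmul_single_top_eq_of_plethysmCoeff_le [CharZero k]
    {f : MvPolynomial σ k} {m : ℕ} (hm : m ≠ 0) (hf : f.IsHomogeneous m) (hf0 : f ≠ 0) (iₘ : σ)
    (hiₘ : ∀ i, i ≤ iₘ) (χ : Weight σ) (n : ℕ)
    (ha : plethysmCoeff k σ m (χ + n • Pi.single iₘ (-(m : ℤ))) ≤ plethysmCoeff k σ m χ) :
    orbitMultiplicity k f m (χ + n • Pi.single iₘ (-(m : ℤ))) = orbitMultiplicity k f m χ := by
  haveI : Infinite k := CharZero.infinite k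
  exact orbitMultiplicity_add_nsmul_eq_of_plethysmCoeff_le f hm χ
    (hasHighestWeight_orbitCoordRep_single_top hf hf0 iₘ hiₘ) n ha

/-- First-row transfer, equation counts: under the same hypotheses
`#eq_{χ + n·(−m ε_{iₘ})} = #eq_χ`. [cite: BurgisserIkenmeyer2013, §3.3 Prop. 3.3] -/
theorem finrank_hwv_inf_orbitVanishingIdeal_add_nsmul_single_top_eq_of_plethysmCoeff_le
    [CharZero k] {f : MvPolynomial σ k} {m : ℕ} (hm : m ≠ 0) (hf : f.IsHomogeneous m)
    (hf0 : f ≠ 0) (iₘ : σ) (hiₘ : ∀ i, i ≤ iₘ) (χ : Weight σ) (n : ℕ)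
    (ha : plethysmCoeff k σ m (χ + n • Pi.single iₘ (-(m : ℤ))) ≤ plethysmCoeff k σ m χ) :
    Module.finrank k ↥(highestWeightSpace (coordRep σ k m) (χ + n • Pi.single iₘ (-(m : ℤ))) ⊓
        (orbitVanishingIdeal f m).restrictScalars k) =
      Module.finrank k ↥(highestWeightSpace (coordRep σ k m) χ ⊓
        (orbitVanishingIdeal f m).restrictScalars k) := by
  haveI : Infinite k := CharZero.infinite k
  exact finrank_hwv_inf_orbitVanishingIdeal_add_nsmul_eq_of_plethysmCoeff_le f hm χ
    (hasHighestWeight_orbitCoordRep_single_top hf hf0 iₘ hiₘ) n ha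

/-- **The plethysm coefficient never decreases along first-row lengthening** (partition form of
`plethysmCoeff_le_plethysmCoeff_add_nsmul` with `a_{−s ε_top} ≥ 1`): `GL_{N²}` on forms of degree
`s ≠ 0` in the `N × N` matrix variables, `k` infinite, `λ` with `λ₂ + s n ≤ λ₁` and
`μ = lowerTop λ (s n)`: `a_{μ^*} ≤ a_{λ^*}`. So the transfer hypothesis `a_{λ^*} ≤ a_{μ^*}` below
is an equality. (BIP 2019 §4.4; Landsberg 2017 Thm. 8.9.1.1 "nondecreasing".)
[cite: BurgisserIkenmeyerPanovaJAMS2019, §4.4] -/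
theorem plethysmCoeff_lowerTop_le [Infinite k] {N s : ℕ} [NeZero N] (hs : s ≠ 0) {D D' : ℕ}
    (lam : Nat.Partition D) (n : ℕ) (hD : D' + s * n = D)
    (hr : secondPart lam + s * n ≤ lam.parts.sup) :
    plethysmCoeff k (MatIdx N) s (partitionWeightLex N (lowerTop lam (s * n) D' hD hr)) ≤
      plethysmCoeff k (MatIdx N) s (partitionWeightLex N lam) := by
  have h := plethysmCoeff_le_plethysmCoeff_add_nsmul (k := k) hs
    (partitionWeightLex N (lowerTop lam (s * n) D' hD hr))
    (one_le_plethysmCoeff_single_top (k := k) hs (topMatIdx N) (le_topMatIdx N)) n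
  rwa [partitionWeightLex_lowerTop_add_nsmul_single lam n hD hr] at h

/-- **Equation counts along first-row lengthening, partition form** (any form `f`, `s ≠ 0`, `k`
infinite): with `λ`, `μ = lowerTop λ (s n)` as above, the number of independent weight-`μ^*`
equations of `Δ_s(f)` is at most the number of weight-`λ^*` equations.
[cite: BurgisserIkenmeyer2013, §3.3 Prop. 3.3] -/
theorem finrank_hwv_inf_orbitVanishingIdeal_lowerTop_le [Infinite k] {N s : ℕ} [NeZero N]
    (f : MvPolynomial (MatIdx N) k) (hs : s ≠ 0) {D D' : ℕ} (lam : Nat.Partition D) (n : ℕ)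
    (hD : D' + s * n = D) (hr : secondPart lam + s * n ≤ lam.parts.sup) :
    Module.finrank k ↥(highestWeightSpace (coordRep (MatIdx N) k s)
        (partitionWeightLex N (lowerTop lam (s * n) D' hD hr)) ⊓
        (orbitVanishingIdeal f s).restrictScalars k) ≤
      Module.finrank k ↥(highestWeightSpace (coordRep (MatIdx N) k s) (partitionWeightLex N lam) ⊓
        (orbitVanishingIdeal f s).restrictScalars k) := by
  have h := finrank_hwv_inf_orbitVanishingIdeal_le_add_nsmul f hs
    (partitionWeightLex N (lowerTop lam (s * n) D' hD hr))
    (one_le_plethysmCoeff_single_top (k := k) hs (topMatIdx N) (le_topMatIdx N)) n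
  rwa [partitionWeightLex_lowerTop_add_nsmul_single lam n hD hr] at h

/-- **Transfer along the first row, partition form (LEMMA Q0 as the cell uses it).** `GL_{N²}`
acting on forms of degree `s ≠ 0` in the `N × N` matrix variables, characteristic zero, weights
`λ^* = partitionWeightLex N λ`; `λ` with `λ₂ + s n ≤ λ₁`, `μ = lowerTop λ (s n)` its first-row
shortening. If the plethysm coefficient is NOT raised by the lengthening, `a_{λ^*} ≤ a_{μ^*}`
(e.g. `a_λ(d[s]) = a_{λ⁻}((d−1)[s])`, `n = 1`), then for EVERY nonzero form `f` of degree `s` —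
`det_s`, `X₀₀^{s−m} per_m`, padded power sums, the Chow form — the closure multiplicity is
inherited exactly: `mult_{λ^*} k[Δ_s(f)] = mult_{μ^*} k[Δ_s(f)]`; with
`finrank_hwv_inf_orbitVanishingIdeal_lowerTop_eq_of_plethysmCoeff_le` the equation counts agree
too, so every sandwich `r ≤ mult ≤ a − #eq` and every fullness / deficiency statement copies from
`μ` to `λ`. [cite: BlaeserIkenmeyer2025, Prop. 21.17 (p. 128)] -/
theorem orbitMultiplicity_lowerTop_eq_of_plethysmCoeff_le [CharZero k] {N s : ℕ} [NeZero N]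
    {f : MvPolynomial (MatIdx N) k} (hs : s ≠ 0) (hf : f.IsHomogeneous s) (hf0 : f ≠ 0)
    {D D' : ℕ} (lam : Nat.Partition D) (n : ℕ) (hD : D' + s * n = D)
    (hr : secondPart lam + s * n ≤ lam.parts.sup)
    (ha : plethysmCoeff k (MatIdx N) s (partitionWeightLex N lam) ≤
      plethysmCoeff k (MatIdx N) s (partitionWeightLex N (lowerTop lam (s * n) D' hD hr))) :
    orbitMultiplicity k f s (partitionWeightLex N lam) =
      orbitMultiplicity k f s (partitionWeightLex N (lowerTop lam (s * n) D' hD hr)) := by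
  have hw := partitionWeightLex_lowerTop_add_nsmul_single (N := N) lam n hD hr
  have h := orbitMultiplicity_add_nsmul_single_top_eq_of_plethysmCoeff_le hs hf hf0 (topMatIdx N)
    (le_topMatIdx N) (partitionWeightLex N (lowerTop lam (s * n) D' hD hr)) n (by rwa [hw])
  rwa [hw] at h

/-- Partition form, equation counts: under the hypotheses of
`orbitMultiplicity_lowerTop_eq_of_plethysmCoeff_le`, `#eq_{λ^*}(Δ_s(f)) = #eq_{μ^*}(Δ_s(f))`.
[cite: BurgisserIkenmeyer2013, §3.3 Prop. 3.3] -/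
theorem finrank_hwv_inf_orbitVanishingIdeal_lowerTop_eq_of_plethysmCoeff_le [CharZero k]
    {N s : ℕ} [NeZero N] {f : MvPolynomial (MatIdx N) k} (hs : s ≠ 0) (hf : f.IsHomogeneous s)
    (hf0 : f ≠ 0) {D D' : ℕ} (lam : Nat.Partition D) (n : ℕ) (hD : D' + s * n = D)
    (hr : secondPart lam + s * n ≤ lam.parts.sup)
    (ha : plethysmCoeff k (MatIdx N) s (partitionWeightLex N lam) ≤
      plethysmCoeff k (MatIdx N) s (partitionWeightLex N (lowerTop lam (s * n) D' hD hr))) :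
    Module.finrank k ↥(highestWeightSpace (coordRep (MatIdx N) k s) (partitionWeightLex N lam) ⊓
        (orbitVanishingIdeal f s).restrictScalars k) =
      Module.finrank k ↥(highestWeightSpace (coordRep (MatIdx N) k s)
        (partitionWeightLex N (lowerTop lam (s * n) D' hD hr)) ⊓
        (orbitVanishingIdeal f s).restrictScalars k) := by
  have hw := partitionWeightLex_lowerTop_add_nsmul_single (N := N) lam n hD hr
  have h := finrank_hwv_inf_orbitVanishingIdeal_add_nsmul_single_top_eq_of_plethysmCoeff_le hs hf
    hf0 (topMatIdx N) (le_topMatIdx N) (partitionWeightLex N (lowerTop lam (s * n) D' hD hr)) n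
    (by rwa [hw])
  rwa [hw] at h

end Transfer

/-! ### 8. The stable range: beyond BIP's threshold `λ₂ + |λ̄| ≤ d` every closure datum is frozen -/

section Stable

/-- The size of `λ^* = partitionWeightLex N λ` is `-|λ|` when `λ` has at most `N²` parts.
[cite: BurgisserIkenmeyerPanovaJAMS2019, §3(b)] -/
private theorem size_partitionWeightLex_of_card_le {N D : ℕ} (lam : Nat.Partition D)
    (hlam : lam.parts.card ≤ N * N) : (partitionWeightLex N lam).size = -(D : ℤ) := by
  rw [partitionWeightLex, Weight.size_toMatIdx, Weight.dualOfPartition, Weight.size_dual,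
    Weight.size_ofPartition_holds hlam]

/-- A nonzero vector lies in at most one highest-weight space of `k[Sym^m]` (its monomials carry
the weight, `monWeight_eq_of_mem_weightSpace`). [cite: BurgisserEtAl2011, §4.4] -/
private theorem weight_eq_of_mem_highestWeightSpace_of_ne_zero {σ k : Type*} [Fintype σ]
    [LinearOrder σ] [Field k] [Infinite k] {m : ℕ} {χ χ' : Weight σ}
    {F : MvPolynomial (DegIdx σ m) k} (hF : F ∈ highestWeightSpace (coordRep σ k m) χ)
    (hF' : F ∈ highestWeightSpace (coordRep σ k m) χ') (hF0 : F ≠ 0) : χ = χ' := by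
  classical
  obtain ⟨s, hs⟩ := MvPolynomial.support_nonempty.mpr hF0
  rw [← monWeight_eq_of_mem_weightSpace (highestWeightSpace_le_weightSpace _ _ hF) hs,
    ← monWeight_eq_of_mem_weightSpace (highestWeightSpace_le_weightSpace _ _ hF') hs]

/-- **Plethysm stability, counted: BIP 2019 Prop. 5.8(2) as an EQUALITY of plethysm coefficients.**
`GL_{N²}` on forms of degree `s ≠ 0` in the `N × N` matrix variables over `ℂ`; `μ ⊢ d·s` with at
most `N²` parts and `μ₂ + |μ̄| ≤ k' ≤ d`; `ν = lowerTop μ (s (d − k')) ⊢ k'·s` (the same body,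
first row shortened by `s (d − k')`). Then `a_{μ^*} = a_{ν^*}`: "`≥`" is the injectivity of the
outer degree lifting `g ↦ (e_1^s)^{d−k'}·g` (`plethysmCoeff_lowerTop_le`), "`≤`" its surjectivity
onto `HWV_{μ^*}` — BIP Prop. 5.8(2): "Suppose that `f` is a highest weight vector in `Sym^d Sym^m V`
of weight `μ ⊢ dm` and assume that `μ₂ + |μ̄| ≤ k ≤ d` for some `k`. Then `μ = ν♯dm` for some
`ν ⊢ mk` and `f = (e_1^m)^{d-k} · g` for some `g ∈ HWV_ν(Sym^k Sym^m V)`" — the tree's DISCHARGED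
`bip2019_prop_5_8_2_holds` (`PlethysmStabilityBIP.lean`). (Landsberg 2017 Thm. 8.9.1.1 after
[Man97]: "constant as soon as `d ≥ |μ|`"; BIP Prop. 4.12.) [cite: BurgisserIkenmeyerPanovaJAMS2019, Prop. 5.8(2)] -/
theorem plethysmCoeff_lowerTop_eq_of_stable {N s : ℕ} [NeZero N] (hs : s ≠ 0) {d k' : ℕ}
    (mu : Nat.Partition (d * s)) (hmu : mu.parts.card ≤ N * N)
    (hk : secondPart mu + bodySize mu ≤ k') (hkd : k' ≤ d) (hD : k' * s + s * (d - k') = d * s)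
    (hr : secondPart mu + s * (d - k') ≤ mu.parts.sup) :
    plethysmCoeff ℂ (MatIdx N) s (partitionWeightLex N mu) =
      plethysmCoeff ℂ (MatIdx N) s (partitionWeightLex N (lowerTop mu (s * (d - k')) (k' * s) hD hr)) := by
  classical
  refine le_antisymm ?_ (plethysmCoeff_lowerTop_le (k := ℂ) hs mu (d - k') hD hr)
  set nu := lowerTop mu (s * (d - k')) (k' * s) hD hr with hnu
  set ψ : Weight (MatIdx N) := Pi.single (topMatIdx N) (-(s : ℤ)) with hψ
  have hw : partitionWeightLex N nu + (d - k') • ψ = partitionWeightLex N mu :=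
    partitionWeightLex_lowerTop_add_nsmul_single (N := N) mu (d - k') hD hr
  haveI : FiniteDimensional ℂ (highestWeightSpace (coordRep (MatIdx N) ℂ s)
      (partitionWeightLex N nu)) :=
    finiteDimensional_highestWeightSpace_coordRep_holds hs _
  -- the outer degree lifting `g ↦ g · (e_1^s)^{d-k'}` as a linear map `HWV_{ν^*} → HWV_{μ^*}`
  have hX : (X (topDegIdx N s) : MvPolynomial (DegIdx (MatIdx N) s) ℂ) ^ (d - k') ∈
      highestWeightSpace (coordRep (MatIdx N) ℂ s) ((d - k') • ψ) :=
    pow_mem_highestWeightSpace_coordRep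
      (X_mem_highestWeightSpace_coordRep (k := ℂ) s (topMatIdx N) (le_topMatIdx N)
        (topDegIdx N s) rfl) (d - k')
  let L : ↥(highestWeightSpace (coordRep (MatIdx N) ℂ s) (partitionWeightLex N nu)) →ₗ[ℂ]
      ↥(highestWeightSpace (coordRep (MatIdx N) ℂ s) (partitionWeightLex N mu)) :=
    { toFun := fun g => ⟨g.1 * X (topDegIdx N s) ^ (d - k'), by
        have h := mul_mem_highestWeightSpace_coordRep g.2 hX
        rwa [hw] at h⟩
      map_add' := fun a b => by
        ext
        simp [add_mul]
      map_smul' := fun c a => by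
        ext
        simp }
  have hL : Function.Surjective L := by
    rintro ⟨f, hf⟩
    by_cases hf0 : f = 0
    · refine ⟨0, Subtype.ext ?_⟩
      simp [L, hf0]
    have hfd : f.IsHomogeneous d :=
      isHomogeneous_of_mem_highestWeightSpace hs hf
        (by rw [size_partitionWeightLex_of_card_le mu hmu, Nat.mul_comm])
    obtain ⟨nu', g, _hnu', _hbody, _hgd, hgw, hfg⟩ :=
      bip2019_prop_5_8_2_holds N s d k' mu hmu hk hkd f hfd hf
    have hg0 : g ≠ 0 := by
      rintro rfl
      exact hf0 (by rw [hfg, mul_zero])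
    -- the weight of `g` is forced: `ν'^* + (d-k')•ψ = μ^* = ν^* + (d-k')•ψ`
    have hfw' : f ∈ highestWeightSpace (coordRep (MatIdx N) ℂ s)
        ((d - k') • ψ + partitionWeightLex N nu') := by
      rw [hfg]
      exact mul_mem_highestWeightSpace_coordRep hX hgw
    have hwt : partitionWeightLex N nu' = partitionWeightLex N nu := by
      have h1 := weight_eq_of_mem_highestWeightSpace_of_ne_zero hf hfw' hf0
      rw [← hw, add_comm] at h1
      exact (add_left_cancel h1).symm
    refine ⟨⟨g, hwt ▸ hgw⟩, Subtype.ext ?_⟩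
    change g * X (topDegIdx N s) ^ (d - k') = f
    rw [hfg, mul_comm]
  exact LinearMap.finrank_le_finrank_of_surjective hL

/-- **Closure multiplicities are frozen in BIP's stable range — for EVERY orbit closure at once
(the cell's LEMMA Q0(d) with a PRINTED threshold).** `GL_{N²}` on forms of degree `s ≠ 0` in the
`N × N` matrix variables over `ℂ`, `f ≠ 0` a form of degree `s` (`det_N` with `s = N`, the padded
permanent `X₀₀^{N−m} per_m`, padded power sums, the Chow form, …); `μ ⊢ d·s` with at most `N²`
parts and `μ₂ + |μ̄| ≤ k' ≤ d`; `ν = lowerTop μ (s (d − k')) ⊢ k'·s`. Then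
`mult_{μ^*} ℂ[Δ_s(f)] = mult_{ν^*} ℂ[Δ_s(f)]`: transfer (`orbitMultiplicity_lowerTop_eq_of_plethysmCoeff_le`)
along the plethysm equality `plethysmCoeff_lowerTop_eq_of_stable`. In body letters: for a body `ρ`
(`ρ₁ = μ₂`, `|ρ| = |μ̄|`) ALL the types `(ds − |ρ|, ρ)`, `d ≥ |ρ| + ρ₁`, have the same closure
multiplicity. [cite: BurgisserIkenmeyerPanovaJAMS2019, Prop. 5.8(2)] -/
theorem orbitMultiplicity_lowerTop_eq_of_stable {N s : ℕ} [NeZero N] (hs : s ≠ 0)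
    {f : MvPolynomial (MatIdx N) ℂ} (hf : f.IsHomogeneous s) (hf0 : f ≠ 0) {d k' : ℕ}
    (mu : Nat.Partition (d * s)) (hmu : mu.parts.card ≤ N * N)
    (hk : secondPart mu + bodySize mu ≤ k') (hkd : k' ≤ d) (hD : k' * s + s * (d - k') = d * s)
    (hr : secondPart mu + s * (d - k') ≤ mu.parts.sup) :
    orbitMultiplicity ℂ f s (partitionWeightLex N mu) =
      orbitMultiplicity ℂ f s (partitionWeightLex N (lowerTop mu (s * (d - k')) (k' * s) hD hr)) :=
  orbitMultiplicity_lowerTop_eq_of_plethysmCoeff_le hs hf hf0 mu (d - k') hD hr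
    (plethysmCoeff_lowerTop_eq_of_stable hs mu hmu hk hkd hD hr).le

/-- … and so are the EQUATION COUNTS: `#eq_{μ^*}(Δ_s(f)) = #eq_{ν^*}(Δ_s(f))` in the stable range
`μ₂ + |μ̄| ≤ k' ≤ d` — hence deficiencies, fullness, and every sandwich `r ≤ mult ≤ a − #eq`
are constant in `d` from `|μ̄| + μ₂` on, for every nonzero form `f` of degree `s`.
[cite: BurgisserIkenmeyerPanovaJAMS2019, Prop. 5.8(2)] -/
theorem finrank_hwv_inf_orbitVanishingIdeal_lowerTop_eq_of_stable {N s : ℕ} [NeZero N]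
    (hs : s ≠ 0) {f : MvPolynomial (MatIdx N) ℂ} (hf : f.IsHomogeneous s) (hf0 : f ≠ 0)
    {d k' : ℕ} (mu : Nat.Partition (d * s)) (hmu : mu.parts.card ≤ N * N)
    (hk : secondPart mu + bodySize mu ≤ k') (hkd : k' ≤ d) (hD : k' * s + s * (d - k') = d * s)
    (hr : secondPart mu + s * (d - k') ≤ mu.parts.sup) :
    Module.finrank ℂ ↥(highestWeightSpace (coordRep (MatIdx N) ℂ s) (partitionWeightLex N mu) ⊓
        (orbitVanishingIdeal f s).restrictScalars ℂ) =
      Module.finrank ℂ ↥(highestWeightSpace (coordRep (MatIdx N) ℂ s)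
        (partitionWeightLex N (lowerTop mu (s * (d - k')) (k' * s) hD hr)) ⊓
        (orbitVanishingIdeal f s).restrictScalars ℂ) :=
  finrank_hwv_inf_orbitVanishingIdeal_lowerTop_eq_of_plethysmCoeff_le hs hf hf0 mu (d - k') hD hr
    (plethysmCoeff_lowerTop_eq_of_stable hs mu hmu hk hkd hD hr).le

end Stable

end Literature.Computability.AlgebraicComplexity
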